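import Literature.Topology.FourManifolds.ArcClosing
import Literature.Topology.FourManifolds.LoopGeneralPositionTwoArcs
import Mathlib.Analysis.Real.Pi.Bounds
import HarnessLib

/-!
# Closing two embedded arcs up to one embedded circle through a path-connected open set
# (Whitney 1936, §II Thm. 5; Milnor 1965, Lemma 6.12 and the proof of Lemma 8.3)

Topic `Literature/Topology/FourManifolds` (trunk T-4MAN); fact seat
`provefact-Literature.Topology.FourManifolds.Knot.exists_isBandSum` (`BandSum.lean`: existence of
band sums, Gompf–Stipsicz (1999), §5.1).  The band joining two disjoint knots `K₁`, `K₂` will be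
built along an **auxiliary embedded circle** which crosses `K₁` once and `K₂` once along two
prescribed germs of arcs (short radial segments of tubular neighbourhoods) and otherwise runs
through the complement of the two knots inside the prescribed open set.  This file provides that
circle: the two-arc form of the tree's arc-closing lemma
`Milnor1965_exists_embedding_circle_through_arc_holds` (`ArcClosing.lean`; Milnor, *Lectures on
the h-cobordism theorem* (1965), proof of Lemma 8.3, PDF p. 56, with Whitney's Lemma 6.12,
PDF p. 42: *"Since `dim V = n - 1 ≥ 3`, Whitney's theorem 6.12 provides a smooth imbedding with
these properties"*).

* `Literature.Topology.FourManifolds.exists_periodic_extension_two` — the `2π`-periodic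
  continuous map which is `γ₁` on `[-1, 1]`, `γ₂ (· - π)` on `[π - 1, π + 1]`, and runs through two
  given paths in between (Mathlib's `AddCircle.liftIco`).
* `Literature.Topology.FourManifolds.exists_isSmoothEmbedding_circle_through_two_arcs` — **the
  two-arc closing lemma**: for a compact Hausdorff manifold `V` of dimension `n ≥ 3`, a
  path-connected open `O ⊆ V`, and two smooth injective immersions `γ₁ γ₂ : ℝ → V` with disjoint
  ranges and `γᵢ t ∈ O` for `t ≠ 0`, there are a smooth embedding `e : S¹ → V` and `h > 0` with
  `e (circlePoint θ) = γ₁ θ` and `e (circlePoint (θ + π)) = γ₂ θ` for `|θ| ≤ h`, and `e s ∈ O` for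
  every `s` other than `circlePoint 0`, `circlePoint π`.

**Proof** (that of `ArcClosing.lean` with two arcs).  (1) Join `γ₁ 1` to `γ₂ (-1)` and `γ₂ 1`
to `γ₁ (-1)` by paths in `O ∖ {γ₁ 0, γ₂ 0}` (twice `isPathConnected_diff_singleton`).  (2) The
`2π`-periodic map through the two arcs and the two paths descends to a continuous loop
`L : S¹ → V` (`CircleLoops.lean`), smooth on the two arcs of angle `1` about `circlePoint 0` and
`circlePoint π`.  (3) Both paths miss `γ₁ [-4h, 4h] ∪ γ₂ [-4h, 4h]` for some `h > 0`; smooth `L`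
keeping it fixed on the two arcs of angle `1/2`, keeping the far part in `O` and off
`γ₁ [-3h, 3h] ∪ γ₂ [-3h, 3h]` (`exists_contMDiff_eqOn_mapsTo`, `MapSmoothing.lean`).  (4) The
smoothed loop is good on the two core arcs of angle `2h` (velocities of `γ₁`, `γ₂`; separation by
injectivity, disjointness of the two ranges and the margin), so the two-arc general-position
theorem `exists_isSmoothEmbedding_of_stagesGoodOn_two_arcs` (`LoopGeneralPositionTwoArcs.lean`)
turns it into an embedding equal to `γ₁`, `γ₂ (· - π)` on the arcs of angle `h` and still mapping
the far part into `O`.  Everything here is proved; no definitions, no named facts.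

## References

* J. Milnor, *Lectures on the h-cobordism theorem* (1965), proof of Lemma 8.3 (PDF pp. 55–56),
  Lemma 6.12 (PDF p. 42). [MilnorHCobordism1965]
* H. Whitney, *Differentiable manifolds*, Ann. of Math. (2) 37 (1936), 645–680, §II Thms. 5–6.
  [Whitney1936]
* R. E. Gompf, A. I. Stipsicz, *4-Manifolds and Kirby Calculus*, GSM 20, AMS (1999), §5.1
  (the consumer: bands between attaching circles). [GompfStipsicz1999]
-/

open scoped Manifold ContDiff Topology Real
open Function Set Filter

noncomputable section

namespace Literature.Topology.FourManifolds

/-! ### The continuous loop through two arcs -/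

section Loop

variable {V : Type*} [TopologicalSpace V]

/-- **A `2π`-periodic continuous map which is `γ₁` on `[-1, 1]`, `γ₂ (· - π)` on `[π - 1, π + 1]`,
and runs through a given path from `γ₁ 1` to `γ₂ (-1)` on `(1, π - 1)` and through a given path
from `γ₂ 1` to `γ₁ (-1)` on `(π + 1, 2π - 1)`.** [folklore] -/
theorem exists_periodic_extension_two {γ₁ γ₂ : ℝ → V} (hγ₁ : Continuous γ₁) (hγ₂ : Continuous γ₂)
    (p₁ : Path (γ₁ 1) (γ₂ (-1))) (p₂ : Path (γ₂ 1) (γ₁ (-1))) :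
    ∃ P : ℝ → V, Continuous P ∧ Periodic P (2 * π) ∧ (∀ θ ∈ Icc (-1 : ℝ) 1, P θ = γ₁ θ) ∧
      (∀ θ ∈ Icc (-1 : ℝ) 1, P (θ + π) = γ₂ θ) ∧
      (∀ θ ∈ Ioo (1 : ℝ) (π - 1), P θ ∈ range p₁) ∧
      ∀ θ ∈ Ioo (π + 1) (2 * π - 1), P θ ∈ range p₂ := by
  haveI : Fact (0 < 2 * π) := ⟨Real.two_pi_pos⟩
  have hπ3 : (3 : ℝ) < π := Real.pi_gt_three
  have hne : (π - 2 : ℝ) ≠ 0 := by linarith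
  -- one period, innermost piece first
  set f₃ : ℝ → V := fun x => if x ≤ π + 1 then γ₂ (x - π) else p₂.extend ((x - π - 1) / (π - 2))
    with hf₃
  have hf₃c : Continuous f₃ := by
    refine Continuous.if_le (hγ₂.comp (by fun_prop)) (p₂.continuous_extend.comp (by fun_prop))
      continuous_id continuous_const ?_
    rintro x rfl
    simp
  set f₂ : ℝ → V := fun x => if x ≤ π - 1 then p₁.extend ((x - 1) / (π - 2)) else f₃ x with hf₂
  have hf₂c : Continuous f₂ := by
    refine Continuous.if_le (p₁.continuous_extend.comp (by fun_prop)) hf₃c continuous_id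
      continuous_const ?_
    rintro x rfl
    have h1 : (π - 1 - 1) / (π - 2) = 1 := by rw [div_eq_one_iff_eq hne]; ring
    have h2 : π - 1 ≤ π + 1 := by linarith
    simp only [hf₃, h2, if_true, h1, Path.extend_one]
    congr 1
    ring
  set P₁ : ℝ → V := fun x => if x ≤ 1 then γ₁ x else f₂ x with hP₁
  have hP₁c : Continuous P₁ := by
    refine Continuous.if_le hγ₁ hf₂c continuous_id continuous_const ?_
    rintro x rfl
    have h2 : (1 : ℝ) ≤ π - 1 := by linarith
    simp [hf₂, h2]
  have hP₁ends : P₁ (-1) = P₁ (-1 + 2 * π) := by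
    have h1 : P₁ (-1) = γ₁ (-1) := by simp [hP₁]
    have hn1 : ¬ (-1 + 2 * π ≤ 1) := by linarith
    have hn2 : ¬ (-1 + 2 * π ≤ π - 1) := by linarith
    have hn3 : ¬ (-1 + 2 * π ≤ π + 1) := by linarith
    have h3 : (-1 + 2 * π - π - 1) / (π - 2) = 1 := by rw [div_eq_one_iff_eq hne]; ring
    have h2 : P₁ (-1 + 2 * π) = p₂.extend 1 := by
      simp only [hP₁, hf₂, hf₃, hn1, hn2, hn3, if_false, h3]
    rw [h1, h2, Path.extend_one]
  set P : ℝ → V := fun θ => AddCircle.liftIco (2 * π) (-1) P₁ (θ : AddCircle (2 * π)) with hP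
  have hPc : Continuous P :=
    (AddCircle.liftIco_continuous hP₁ends hP₁c.continuousOn).comp (AddCircle.continuous_mk' _)
  have hPper : Periodic P (2 * π) := fun θ => by
    simp only [hP]
    rw [AddCircle.coe_add_period]
  have hPeq : ∀ θ ∈ Ico (-1 : ℝ) (-1 + 2 * π), P θ = P₁ θ := fun θ hθ =>
    AddCircle.liftIco_coe_apply hθ
  refine ⟨P, hPc, hPper, fun θ hθ => ?_, fun θ hθ => ?_, fun θ hθ => ?_, fun θ hθ => ?_⟩
  · rw [hPeq θ ⟨hθ.1, by linarith [hθ.2]⟩]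
    simp [hP₁, hθ.2]
  · rw [hPeq (θ + π) ⟨by linarith [hθ.1], by linarith [hθ.2]⟩]
    have hn1 : ¬ (θ + π ≤ 1) := by linarith [hθ.1]
    rcases eq_or_lt_of_le hθ.1 with h | h
    · -- the left end `θ = -1`: the first path has just arrived at `γ₂ (-1)`
      subst h
      have h2 : (-1 + π ≤ π - 1) := by linarith
      have h3 : (-1 + π - 1) / (π - 2) = 1 := by rw [div_eq_one_iff_eq hne]; ring
      simp only [hP₁, hf₂, hn1, if_false, h2, if_true, h3, Path.extend_one]
    · have hn2 : ¬ (θ + π ≤ π - 1) := by linarith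
      have h3 : θ + π ≤ π + 1 := by linarith [hθ.2]
      simp only [hP₁, hf₂, hf₃, hn1, hn2, if_false, h3, if_true]
      congr 1
      ring
  · rw [hPeq θ ⟨by linarith [hθ.1], by linarith [hθ.2]⟩]
    have hn1 : ¬ θ ≤ 1 := not_le.2 hθ.1
    have h2 : θ ≤ π - 1 := hθ.2.le
    simp only [hP₁, hf₂, hn1, if_false, h2, if_true]
    exact Path.extend_mem_range p₁ _
  · rw [hPeq θ ⟨by linarith [hθ.1], by linarith [hθ.2]⟩]
    have hn1 : ¬ θ ≤ 1 := by linarith [hθ.1]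
    have hn2 : ¬ θ ≤ π - 1 := by linarith [hθ.1]
    have hn3 : ¬ θ ≤ π + 1 := not_le.2 hθ.1
    simp only [hP₁, hf₂, hf₃, hn1, hn2, hn3, if_false]
    exact Path.extend_mem_range p₂ _

end Loop

/-! ### The two-arc closing lemma -/

section TwoArcs

variable {n : ℕ} {V : Type*} [TopologicalSpace V] [ChartedSpace (EuclideanSpace ℝ (Fin n)) V]
  [IsManifold (𝓡 n) ∞ V]

set_option backward.isDefEq.respectTransparency false in
/-- **Closing two embedded arcs up to an embedded circle through a path-connected open set**
(Milnor 1965, proof of Lemma 8.3 with Whitney's Lemma 6.12, for two arcs): in a compact Hausdorff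
manifold of dimension `n ≥ 3`, let `γ₁ γ₂ : ℝ → V` be smooth injective immersions with disjoint
ranges whose points other than `γ₁ 0`, `γ₂ 0` lie in a path-connected open set `O`.  Then there are
a smooth embedding `e : S¹ → V` and `h > 0` such that `e (circlePoint θ) = γ₁ θ` and
`e (circlePoint (θ + π)) = γ₂ θ` for `|θ| ≤ h`, and `e s ∈ O` for all `s ≠ circlePoint 0, circlePoint π`.
[cite: MilnorHCobordism1965, proof of Lemma 8.3 (PDF p. 56) and Lemma 6.12 (PDF p. 42)] [cite: Whitney1936, §II Thm. 5] -/
theorem exists_isSmoothEmbedding_circle_through_two_arcs [T2Space V] [SecondCountableTopology V]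
    [CompactSpace V] (hn : 3 ≤ n) {O : Set V} (hO : IsOpen O) (hOpc : IsPathConnected O)
    {γ₁ γ₂ : ℝ → V} (hγ₁s : ContMDiff 𝓘(ℝ, ℝ) (𝓡 n) ∞ γ₁) (hγ₂s : ContMDiff 𝓘(ℝ, ℝ) (𝓡 n) ∞ γ₂)
    (hγ₁inj : Injective γ₁) (hγ₂inj : Injective γ₂)
    (hγ₁imm : ∀ t, Injective (mfderiv 𝓘(ℝ, ℝ) (𝓡 n) γ₁ t))
    (hγ₂imm : ∀ t, Injective (mfderiv 𝓘(ℝ, ℝ) (𝓡 n) γ₂ t))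
    (hγ₁O : ∀ t ≠ 0, γ₁ t ∈ O) (hγ₂O : ∀ t ≠ 0, γ₂ t ∈ O)
    (hdisj : Disjoint (range γ₁) (range γ₂)) :
    ∃ e : (Metric.sphere (0 : EuclideanSpace ℝ (Fin 2)) 1) → V,
      ContMDiff (𝓡 1) (𝓡 n) ∞ e ∧ Manifold.IsSmoothEmbedding (𝓡 1) (𝓡 n) ∞ e ∧
      ∃ h : ℝ, 0 < h ∧ (∀ θ : ℝ, |θ| ≤ h → e (circlePoint θ) = γ₁ θ) ∧
        (∀ θ : ℝ, |θ| ≤ h → e (circlePoint (θ + π)) = γ₂ θ) ∧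
        ∀ s, s ≠ circlePoint 0 → s ≠ circlePoint π → e s ∈ O := by
  have hγ₁c : Continuous γ₁ := hγ₁s.continuous
  have hγ₂c : Continuous γ₂ := hγ₂s.continuous
  have hπ3 : (3 : ℝ) < π := Real.pi_gt_three
  have hπ4 : π < 4 := by linarith [Real.pi_lt_d2]
  have hd12 : ∀ s t, γ₁ s ≠ γ₂ t := fun s t h =>
    Set.disjoint_left.1 hdisj ⟨s, rfl⟩ ⟨t, h.symm⟩
  -- ### (1) paths in `O` avoiding `γ₁ 0` and `γ₂ 0`
  set O₂ : Set V := (O \ {γ₁ 0}) \ {γ₂ 0} with hO₂def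
  have hO₂pc : IsPathConnected O₂ :=
    isPathConnected_diff_singleton hn (hO.sdiff isClosed_singleton)
      (isPathConnected_diff_singleton hn hO hOpc (γ₁ 0)) (γ₂ 0)
  have hO₂O : O₂ ⊆ O := fun x hx => hx.1.1
  have mem₁ : ∀ t ≠ (0 : ℝ), γ₁ t ∈ O₂ := fun t ht =>
    ⟨⟨hγ₁O t ht, fun h => ht (hγ₁inj h)⟩, fun h => hd12 t 0 h⟩
  have mem₂ : ∀ t ≠ (0 : ℝ), γ₂ t ∈ O₂ := fun t ht =>
    ⟨⟨hγ₂O t ht, fun h => hd12 0 t h.symm⟩, fun h => ht (hγ₂inj h)⟩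
  obtain ⟨pth₁, hpth₁⟩ : ∃ pth : Path (γ₁ 1) (γ₂ (-1)), ∀ t, pth t ∈ O₂ :=
    ⟨(hO₂pc.joinedIn _ (mem₁ 1 one_ne_zero) _ (mem₂ (-1) (by norm_num))).somePath,
      (hO₂pc.joinedIn _ (mem₁ 1 one_ne_zero) _ (mem₂ (-1) (by norm_num))).somePath_mem⟩
  obtain ⟨pth₂, hpth₂⟩ : ∃ pth : Path (γ₂ 1) (γ₁ (-1)), ∀ t, pth t ∈ O₂ :=
    ⟨(hO₂pc.joinedIn _ (mem₂ 1 one_ne_zero) _ (mem₁ (-1) (by norm_num))).somePath,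
      (hO₂pc.joinedIn _ (mem₂ 1 one_ne_zero) _ (mem₁ (-1) (by norm_num))).somePath_mem⟩
  -- ### (2) the continuous loop through the two arcs
  obtain ⟨P, hPc, hPper, hPγ₁, hPγ₂, hPp₁, hPp₂⟩ := exists_periodic_extension_two hγ₁c hγ₂c pth₁ pth₂
  obtain ⟨L, hL⟩ := exists_fun_comp_circlePoint_eq hPper
  have hLP : L ∘ circlePoint = P := funext hL
  have hLc : Continuous L := continuous_of_comp_circlePoint (by rw [hLP]; exact hPc)
  have hLγ₁ : ∀ θ : ℝ, |θ| ≤ 1 → L (circlePoint θ) = γ₁ θ := fun θ hθ => by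
    rw [hL]
    exact hPγ₁ θ (abs_le.1 hθ)
  have hLγ₂ : ∀ θ : ℝ, |θ| ≤ 1 → L (circlePoint (θ + π)) = γ₂ θ := fun θ hθ => by
    rw [hL]
    exact hPγ₂ θ (abs_le.1 hθ)
  have hLγ₂' : ∀ θ : ℝ, |θ - π| ≤ 1 → L (circlePoint θ) = γ₂ (θ - π) := fun θ hθ => by
    rw [show circlePoint θ = circlePoint (θ - π + π) by rw [sub_add_cancel]]
    exact hLγ₂ _ hθ
  have hLsmooth₁ : ∀ θ : ℝ, |θ| < 1 → ContMDiffAt (𝓡 1) (𝓡 n) ∞ L (circlePoint θ) := by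
    intro θ hθ
    apply contMDiffAt_of_comp_circlePoint
    have hev : (L ∘ circlePoint) =ᶠ[𝓝 θ] γ₁ := by
      have ho : IsOpen {x : ℝ | |x| < 1} := isOpen_lt continuous_abs continuous_const
      filter_upwards [ho.mem_nhds hθ] with x hx
      exact hLγ₁ x (le_of_lt hx)
    exact (hγ₁s θ).congr_of_eventuallyEq hev
  have hLsmooth₂ : ∀ θ : ℝ, |θ - π| < 1 → ContMDiffAt (𝓡 1) (𝓡 n) ∞ L (circlePoint θ) := by
    intro θ hθ
    apply contMDiffAt_of_comp_circlePoint
    have hev : (L ∘ circlePoint) =ᶠ[𝓝 θ] fun x => γ₂ (x - π) := by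
      have ho : IsOpen {x : ℝ | |x - π| < 1} :=
        isOpen_lt (continuous_abs.comp (continuous_id.sub continuous_const)) continuous_const
      filter_upwards [ho.mem_nhds hθ] with x hx
      exact hLγ₂' x (le_of_lt hx)
    exact ((hγ₂s (θ - π)).comp θ (contMDiffAt_id.sub contMDiffAt_const)).congr_of_eventuallyEq hev
  -- ### (3) the margin `h`: both paths miss `γ₁ [-4h, 4h] ∪ γ₂ [-4h, 4h]`
  set Z : Set ℝ := {x | γ₁ x ∈ range pth₁} ∪ {x | γ₁ x ∈ range pth₂} ∪
    ({x | γ₂ x ∈ range pth₁} ∪ {x | γ₂ x ∈ range pth₂}) with hZdef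
  have hZ : IsClosed Z := by
    have c1 := (isCompact_range pth₁.continuous).isClosed
    have c2 := (isCompact_range pth₂.continuous).isClosed
    exact ((c1.preimage hγ₁c).union (c2.preimage hγ₁c)).union
      ((c1.preimage hγ₂c).union (c2.preimage hγ₂c))
  have h0Z : (0 : ℝ) ∈ Zᶜ := by
    rintro ((⟨t, ht⟩ | ⟨t, ht⟩) | (⟨t, ht⟩ | ⟨t, ht⟩))
    · exact (hpth₁ t).1.2 ht
    · exact (hpth₂ t).1.2 ht
    · exact (hpth₁ t).2 ht
    · exact (hpth₂ t).2 ht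
  obtain ⟨h, hh0, hh16, hhZ⟩ : ∃ h : ℝ, 0 < h ∧ h ≤ 1 / 16 ∧ ∀ x : ℝ, |x| ≤ 4 * h → x ∉ Z := by
    obtain ⟨ε, hε, hball⟩ := Metric.isOpen_iff.1 hZ.isOpen_compl 0 h0Z
    refine ⟨min (ε / 8) (1 / 16), lt_min (by linarith) (by norm_num), min_le_right _ _,
      fun x hx hmem => hball ?_ hmem⟩
    rw [Metric.mem_ball, Real.dist_eq, sub_zero]
    have : min (ε / 8) (1 / 16) ≤ ε / 8 := min_le_left _ _
    linarith [abs_nonneg x]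
  have hhπ : 2 * h < π / 2 := by linarith
  -- unpacking the margin
  have hZ₁₁ : ∀ x : ℝ, |x| ≤ 4 * h → γ₁ x ∉ range pth₁ := fun x hx hm =>
    hhZ x hx (Or.inl (Or.inl hm))
  have hZ₁₂ : ∀ x : ℝ, |x| ≤ 4 * h → γ₁ x ∉ range pth₂ := fun x hx hm =>
    hhZ x hx (Or.inl (Or.inr hm))
  have hZ₂₁ : ∀ x : ℝ, |x| ≤ 4 * h → γ₂ x ∉ range pth₁ := fun x hx hm =>
    hhZ x hx (Or.inr (Or.inl hm))
  have hZ₂₂ : ∀ x : ℝ, |x| ≤ 4 * h → γ₂ x ∉ range pth₂ := fun x hx hm =>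
    hhZ x hx (Or.inr (Or.inr hm))
  -- ### `L` on the far part: in `O`, and off `γ₁ [-3h, 3h] ∪ γ₂ [-3h, 3h]`
  set Wc : Set V := (γ₁ '' Icc (-(3 * h)) (3 * h) ∪ γ₂ '' Icc (-(3 * h)) (3 * h))ᶜ with hWcdef
  have hWco : IsOpen Wc :=
    ((isCompact_Icc.image hγ₁c).union (isCompact_Icc.image hγ₂c)).isClosed.isOpen_compl
  -- points of `γ₁`, `γ₂` with parameter `≥ 1/2` in absolute value, and path points, are in `Wc`
  have hWcγ₁ : ∀ x : ℝ, 1 / 2 ≤ |x| → γ₁ x ∈ Wc := by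
    rintro x hx (⟨y, hy, hye⟩ | ⟨y, hy, hye⟩)
    · have := hγ₁inj hye
      subst this
      have : |y| ≤ 3 * h := abs_le.2 ⟨hy.1, hy.2⟩
      linarith
    · exact hd12 x y hye.symm
  have hWcγ₂ : ∀ x : ℝ, 1 / 2 ≤ |x| → γ₂ x ∈ Wc := by
    rintro x hx (⟨y, hy, hye⟩ | ⟨y, hy, hye⟩)
    · exact hd12 y x hye
    · have := hγ₂inj hye
      subst this
      have : |y| ≤ 3 * h := abs_le.2 ⟨hy.1, hy.2⟩
      linarith
  have hWcp₁ : range pth₁ ⊆ Wc := by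
    rintro z hz (⟨y, hy, rfl⟩ | ⟨y, hy, rfl⟩)
    · exact hZ₁₁ y (abs_le.2 ⟨by linarith [hy.1], by linarith [hy.2]⟩) hz
    · exact hZ₂₁ y (abs_le.2 ⟨by linarith [hy.1], by linarith [hy.2]⟩) hz
  have hWcp₂ : range pth₂ ⊆ Wc := by
    rintro z hz (⟨y, hy, rfl⟩ | ⟨y, hy, rfl⟩)
    · exact hZ₁₂ y (abs_le.2 ⟨by linarith [hy.1], by linarith [hy.2]⟩) hz
    · exact hZ₂₂ y (abs_le.2 ⟨by linarith [hy.1], by linarith [hy.2]⟩) hz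
  have hp₁O : range pth₁ ⊆ O := by
    rintro _ ⟨t, rfl⟩
    exact hO₂O (hpth₁ t)
  have hp₂O : range pth₂ ⊆ O := by
    rintro _ ⟨t, rfl⟩
    exact hO₂O (hpth₂ t)
  -- values of `L` at angles `θ ∈ [h, 2π - h] ∖ (π - h, π + h)`
  have hLval : ∀ θ ∈ Icc h (2 * π - h), (θ ≤ π - h ∨ π + h ≤ θ) →
      L (circlePoint θ) ∈ O ∧
        ((1 / 2 ≤ θ ∧ θ ≤ π - 1 / 2) ∨ (π + 1 / 2 ≤ θ ∧ θ ≤ 2 * π - 1 / 2) →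
          L (circlePoint θ) ∈ Wc) := by
    intro θ hθ hθπ
    by_cases h1 : θ ≤ 1
    · -- on the first arc, to the right of its midpoint
      have hval : L (circlePoint θ) = γ₁ θ := hLγ₁ θ (abs_le.2 ⟨by linarith [hθ.1], h1⟩)
      rw [hval]
      refine ⟨hγ₁O θ (by linarith [hθ.1]), fun hW => hWcγ₁ θ ?_⟩
      rw [abs_of_pos (by linarith [hθ.1])]
      rcases hW with hW | hW
      · exact hW.1
      · linarith [hW.1]
    by_cases h2 : θ < π - 1
    · -- on the first path
      have hval : L (circlePoint θ) ∈ range pth₁ := by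
        rw [hL]
        exact hPp₁ θ ⟨lt_of_not_ge h1, h2⟩
      exact ⟨hp₁O hval, fun _ => hWcp₁ hval⟩
    by_cases h3 : θ ≤ π + 1
    · -- on the second arc
      have habs : |θ - π| ≤ 1 := abs_le.2 ⟨by linarith [not_lt.1 h2], by linarith⟩
      have hval : L (circlePoint θ) = γ₂ (θ - π) := hLγ₂' θ habs
      rw [hval]
      have hne : θ - π ≠ 0 := by
        rcases hθπ with h' | h'
        · intro h0; linarith
        · intro h0; linarith
      refine ⟨hγ₂O _ hne, fun hW => hWcγ₂ _ ?_⟩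
      rcases hW with hW | hW
      · rw [abs_of_nonpos (by linarith [hW.2])]
        linarith [hW.2]
      · rw [abs_of_nonneg (by linarith [hW.1])]
        linarith [hW.1]
    by_cases h4 : θ < 2 * π - 1
    · -- on the second path
      have hval : L (circlePoint θ) ∈ range pth₂ := by
        rw [hL]
        exact hPp₂ θ ⟨lt_of_not_ge h3, h4⟩
      exact ⟨hp₂O hval, fun _ => hWcp₂ hval⟩
    · -- on the first arc, to the left of its midpoint (one period later)
      rw [not_lt] at h4
      have hval : L (circlePoint θ) = γ₁ (θ - 2 * π) := by
        rw [hL, show θ = θ - 2 * π + 2 * π by ring, hPper, add_sub_cancel_right]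
        exact hPγ₁ _ ⟨by linarith, by linarith [hθ.2]⟩
      rw [hval]
      refine ⟨hγ₁O _ (by linarith [hθ.2]), fun hW => hWcγ₁ _ ?_⟩
      rw [abs_of_nonpos (by linarith [hθ.2])]
      rcases hW with hW | hW
      · linarith [hW.2]
      · linarith [hW.2]
  -- lifts of far points
  set D : Set ((Metric.sphere (0 : EuclideanSpace ℝ (Fin 2)) 1)) :=
    {u | angCos 0 u ≤ Real.cos h ∧ angCos π u ≤ Real.cos h} with hDdef
  set D' : Set ((Metric.sphere (0 : EuclideanSpace ℝ (Fin 2)) 1)) :=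
    {u | angCos 0 u ≤ Real.cos (1 / 2) ∧ angCos π u ≤ Real.cos (1 / 2)} with hD'def
  have hDc : IsCompact D :=
    ((isClosed_le (continuous_angCos 0) continuous_const).inter
      (isClosed_le (continuous_angCos π) continuous_const)).isCompact
  have hD'c : IsCompact D' :=
    ((isClosed_le (continuous_angCos 0) continuous_const).inter
      (isClosed_le (continuous_angCos π) continuous_const)).isCompact
  have hLD : MapsTo L D O := fun u hu => by
    obtain ⟨θ, hθ, rfl⟩ := exists_mem_Icc_union_circlePoint_eq_of_angCos_le (b := h) (by linarith)
      hu.1 hu.2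
    rcases hθ with hθ | hθ
    · exact (hLval θ ⟨hθ.1, by linarith [hθ.2]⟩ (Or.inl hθ.2)).1
    · exact (hLval θ ⟨by linarith [hθ.1], hθ.2⟩ (Or.inr hθ.1)).1
  have hLD' : MapsTo L D' Wc := fun u hu => by
    obtain ⟨θ, hθ, rfl⟩ := exists_mem_Icc_union_circlePoint_eq_of_angCos_le (b := 1 / 2)
      (by linarith) hu.1 hu.2
    rcases hθ with hθ | hθ
    · exact (hLval θ ⟨by linarith [hθ.1], by linarith [hθ.2]⟩ (Or.inl (by linarith [hθ.2]))).2
        (Or.inl ⟨hθ.1, hθ.2⟩)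
    · exact (hLval θ ⟨by linarith [hθ.1], by linarith [hθ.2]⟩ (Or.inr (by linarith [hθ.1]))).2
        (Or.inr ⟨hθ.1, hθ.2⟩)
  -- ### smoothing relative to the two arcs of angle `1/2`
  have hLW : ContMDiffOn (𝓡 1) (𝓡 n) ∞ L (circleArc 0 1 ∪ circleArc π 1) := by
    rintro u (hu | hu)
    · obtain ⟨θ, hθ, rfl⟩ := exists_abs_lt_of_mem_circleArc hu zero_le_one
      rw [sub_zero] at hθ
      exact (hLsmooth₁ θ hθ).contMDiffWithinAt
    · obtain ⟨θ, hθ, rfl⟩ := exists_abs_lt_of_mem_circleArc hu zero_le_one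
      exact (hLsmooth₂ θ hθ).contMDiffWithinAt
  have hSW : circleClosedArc 0 (1 / 2) ∪ circleClosedArc π (1 / 2) ⊆ circleArc 0 1 ∪ circleArc π 1 :=
    union_subset_union (circleClosedArc_subset_arc (by norm_num) (by norm_num) (by linarith))
      (circleClosedArc_subset_arc (by norm_num) (by norm_num) (by linarith))
  obtain ⟨G₀, hG₀s, hG₀L, hG₀cons⟩ := exists_contMDiff_eqOn_mapsTo (IM := 𝓡 1) hLc
    ((isClosed_circleClosedArc 0 (1 / 2)).union (isClosed_circleClosedArc π (1 / 2)))
    ((isOpen_circleArc 0 1).union (isOpen_circleArc π 1)) hSW hLW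
    (ι := Bool) (C := fun b => cond b D D') (U := fun b => cond b O Wc)
    (fun b => by cases b <;> assumption) (fun b => by cases b <;> assumption)
    (fun b => by cases b <;> assumption)
  have hG₀D : MapsTo G₀ D O := hG₀cons true
  have hG₀D' : MapsTo G₀ D' Wc := hG₀cons false
  -- `G₀` is `γ₁` on the arc of angle `1/2` at `0`, and `γ₂ (· - π)` on the one at `π`
  have hG₀γ₁ : ∀ θ : ℝ, |θ| ≤ 1 / 2 → G₀ (circlePoint θ) = γ₁ θ := fun θ hθ => by
    rw [hG₀L (Or.inl (circlePoint_mem_circleClosedArc_of_abs_le (by rwa [sub_zero]) (by linarith)))]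
    exact hLγ₁ θ (by linarith)
  have hG₀γ₂ : ∀ θ : ℝ, |θ - π| ≤ 1 / 2 → G₀ (circlePoint θ) = γ₂ (θ - π) := fun θ hθ => by
    rw [hG₀L (Or.inr (circlePoint_mem_circleClosedArc_of_abs_le hθ (by linarith)))]
    exact hLγ₂' θ (by linarith)
  -- ### (4) the smoothed loop is good on the two core arcs of angle `2h`
  have hgood : StagesGoodOn n (fun p : ℝ × (Metric.sphere (0 : EuclideanSpace ℝ (Fin 2)) 1) => G₀ p.2)
      (univ ×ˢ (circleClosedArc 0 (2 * h) ∪ circleClosedArc π (2 * h))) := by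
    refine stagesGoodOn_const_iff.2 ⟨fun s hs => ?_, fun u u' hu heq => ?_⟩
    · -- velocity: near `s` the lift of `G₀` is a translate of `γ₁` or of `γ₂`
      rcases hs with hs | hs
      · have hs' : circlePoint s ∈ circleArc 0 (3 * h) :=
          circleClosedArc_subset_arc (by linarith) (by linarith) (by linarith) hs
        obtain ⟨s₀, hs₀, hs₀s⟩ := exists_abs_lt_of_mem_circleArc hs' (by linarith)
        rw [sub_zero] at hs₀
        obtain ⟨k, hk⟩ := exists_eq_add_of_circlePoint_eq hs₀s.symm
        refine thetaVel_const_ne_zero_of_eventuallyEq_curve (γ := γ₁) (d := (k : ℝ) * (2 * π)) hγ₁s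
          (hγ₁imm _) ?_
        have ho : IsOpen {r : ℝ | |r - (k : ℝ) * (2 * π)| < 1 / 2} :=
          isOpen_lt (continuous_abs.comp (continuous_id.sub continuous_const)) continuous_const
        have hsmem : s ∈ {r : ℝ | |r - (k : ℝ) * (2 * π)| < 1 / 2} := by
          change |s - (k : ℝ) * (2 * π)| < 1 / 2
          rw [hk, add_sub_cancel_right]
          linarith
        filter_upwards [ho.mem_nhds hsmem] with r hr
        change G₀ (circlePoint r) = γ₁ (r - (k : ℝ) * (2 * π))
        have hcp : circlePoint r = circlePoint (r - (k : ℝ) * (2 * π)) := by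
          rw [circlePoint_eq_circlePoint_iff]
          exact ⟨k, by ring⟩
        rw [hcp]
        exact hG₀γ₁ _ (le_of_lt hr)
      · have hs' : circlePoint s ∈ circleArc π (3 * h) :=
          circleClosedArc_subset_arc (by linarith) (by linarith) (by linarith) hs
        obtain ⟨s₀, hs₀, hs₀s⟩ := exists_abs_lt_of_mem_circleArc hs' (by linarith)
        obtain ⟨k, hk⟩ := exists_eq_add_of_circlePoint_eq hs₀s.symm
        refine thetaVel_const_ne_zero_of_eventuallyEq_curve (γ := γ₂)
          (d := π + (k : ℝ) * (2 * π)) hγ₂s (hγ₂imm _) ?_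
        have ho : IsOpen {r : ℝ | |r - (k : ℝ) * (2 * π) - π| < 1 / 2} :=
          isOpen_lt (continuous_abs.comp ((continuous_id.sub continuous_const).sub continuous_const))
            continuous_const
        have hsmem : s ∈ {r : ℝ | |r - (k : ℝ) * (2 * π) - π| < 1 / 2} := by
          change |s - (k : ℝ) * (2 * π) - π| < 1 / 2
          rw [hk, add_sub_cancel_right]
          linarith
        filter_upwards [ho.mem_nhds hsmem] with r hr
        change G₀ (circlePoint r) = γ₂ (r - (π + (k : ℝ) * (2 * π)))
        have hcp : circlePoint r = circlePoint (r - (k : ℝ) * (2 * π)) := by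
          rw [circlePoint_eq_circlePoint_iff]
          exact ⟨k, by ring⟩
        rw [hcp, hG₀γ₂ _ (le_of_lt hr)]
        congr 1
        ring
    · -- separation
      -- the three kinds of points `u'`
      have key : ∀ z : V, (∃ θ : ℝ, |θ| < 3 * h ∧ z = γ₁ θ) ∨ (∃ θ : ℝ, |θ| < 3 * h ∧ z = γ₂ θ) →
          G₀ u' = z → (∃ θ' : ℝ, z = γ₁ θ' ∧ u' = circlePoint θ') ∨
            (∃ θ' : ℝ, z = γ₂ θ' ∧ u' = circlePoint (θ' + π)) := by
        intro z hz heq'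
        by_cases hu'0 : Real.cos (1 / 2) ≤ angCos 0 u'
        · -- `u'` on the arc of angle `1/2` at `0`
          have hu'' : u' ∈ circleArc 0 (3 / 4) :=
            circleClosedArc_subset_arc (by norm_num) (by norm_num) (by linarith) hu'0
          obtain ⟨θ', hθ', rfl⟩ := exists_abs_lt_of_mem_circleArc hu'' (by norm_num)
          rw [sub_zero] at hθ'
          have hGu' : G₀ (circlePoint θ') = γ₁ θ' := by
            rw [hG₀L (Or.inl hu'0)]
            exact hLγ₁ θ' (by linarith)
          exact Or.inl ⟨θ', by rw [← heq', hGu'], rfl⟩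
        by_cases hu'π : Real.cos (1 / 2) ≤ angCos π u'
        · -- `u'` on the arc of angle `1/2` at `π`
          have hu'' : u' ∈ circleArc π (3 / 4) :=
            circleClosedArc_subset_arc (by norm_num) (by norm_num) (by linarith) hu'π
          obtain ⟨θ', hθ', rfl⟩ := exists_abs_lt_of_mem_circleArc hu'' (by norm_num)
          have hGu' : G₀ (circlePoint θ') = γ₂ (θ' - π) := by
            rw [hG₀L (Or.inr hu'π)]
            exact hLγ₂' θ' (by linarith)
          exact Or.inr ⟨θ' - π, by rw [← heq', hGu'], by rw [sub_add_cancel]⟩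
        · -- `u' ∈ D'`: its image is off `γ₁ [-3h, 3h] ∪ γ₂ [-3h, 3h]`, contradiction
          have hmem : G₀ u' ∈ Wc := hG₀D' ⟨le_of_not_ge hu'0, le_of_not_ge hu'π⟩
          rw [heq'] at hmem
          exfalso
          rcases hz with ⟨θ, hθ, rfl⟩ | ⟨θ, hθ, rfl⟩
          · exact hmem (Or.inl ⟨θ, ⟨by linarith [abs_lt.1 hθ |>.1], by linarith [abs_lt.1 hθ |>.2]⟩, rfl⟩)
          · exact hmem (Or.inr ⟨θ, ⟨by linarith [abs_lt.1 hθ |>.1], by linarith [abs_lt.1 hθ |>.2]⟩, rfl⟩)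
      rcases hu with hu | hu
      · have hu3 : u ∈ circleArc 0 (3 * h) :=
          circleClosedArc_subset_arc (by linarith) (by linarith) (by linarith) hu
        obtain ⟨θ, hθ, rfl⟩ := exists_abs_lt_of_mem_circleArc hu3 (by linarith)
        rw [sub_zero] at hθ
        have hGu : G₀ (circlePoint θ) = γ₁ θ := hG₀γ₁ θ (by linarith [abs_nonneg θ])
        rcases key (γ₁ θ) (Or.inl ⟨θ, hθ, rfl⟩) (heq.symm.trans hGu) with ⟨θ', h1, h2⟩ | ⟨θ', h1, h2⟩
        · rw [h2, hγ₁inj h1]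
        · exact absurd h1 (hd12 θ θ')
      · have hu3 : u ∈ circleArc π (3 * h) :=
          circleClosedArc_subset_arc (by linarith) (by linarith) (by linarith) hu
        obtain ⟨θ, hθ, rfl⟩ := exists_abs_lt_of_mem_circleArc hu3 (by linarith)
        have hGu : G₀ (circlePoint θ) = γ₂ (θ - π) := hG₀γ₂ θ (by linarith [abs_nonneg (θ - π)])
        rcases key (γ₂ (θ - π)) (Or.inr ⟨θ - π, hθ, rfl⟩) (heq.symm.trans hGu) with
          ⟨θ', h1, h2⟩ | ⟨θ', h1, h2⟩
        · exact absurd h1.symm (hd12 θ' (θ - π))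
        · rw [h2, ← hγ₂inj h1, sub_add_cancel]
  -- ### general position away from the arcs of angle `h`
  obtain ⟨e, hes, hemb, heD, heG₀⟩ := exists_isSmoothEmbedding_of_stagesGoodOn_two_arcs hn hG₀s
    hh0 (by linarith) hhπ hgood (ι := Unit) (C := fun _ => D) (U := fun _ => O)
    (fun _ => hDc) (fun _ => hO) (fun _ => hG₀D)
  have heD' : MapsTo e D O := heD ()
  have heγ₁ : ∀ θ : ℝ, |θ| ≤ h → e (circlePoint θ) = γ₁ θ := fun θ hθ => by
    rw [heG₀ (Or.inl (circlePoint_mem_circleClosedArc_of_abs_le (by rwa [sub_zero]) (by linarith)))]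
    exact hG₀γ₁ θ (by linarith)
  have heγ₂ : ∀ θ : ℝ, |θ - π| ≤ h → e (circlePoint θ) = γ₂ (θ - π) := fun θ hθ => by
    rw [heG₀ (Or.inr (circlePoint_mem_circleClosedArc_of_abs_le hθ (by linarith)))]
    exact hG₀γ₂ θ (by linarith)
  -- ### assembly
  refine ⟨e, hes, hemb, h, hh0, heγ₁, fun θ hθ => ?_, fun s hs0 hsπ => ?_⟩
  · rw [heγ₂ (θ + π) (by rwa [add_sub_cancel_right]), add_sub_cancel_right]
  · by_cases hsD : s ∈ D
    · exact heD' hsD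
    · rw [hDdef, mem_setOf_eq, not_and_or] at hsD
      rcases hsD with hsD | hsD
      · obtain ⟨θ, hθ, rfl⟩ := exists_abs_lt_of_mem_circleArc (lt_of_not_ge hsD) hh0.le
        rw [sub_zero] at hθ
        rw [heγ₁ θ hθ.le]
        refine hγ₁O θ fun h0 => hs0 ?_
        rw [h0]
      · obtain ⟨θ, hθ, rfl⟩ := exists_abs_lt_of_mem_circleArc (lt_of_not_ge hsD) hh0.le
        rw [heγ₂ θ hθ.le]
        refine hγ₂O _ fun h0 => hsπ ?_
        rw [show θ = π by linarith]

end TwoArcs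

end Literature.Topology.FourManifolds
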